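import Summits.BirchSwinnertonDyer.BirchSwinnertonDyer.Theses.LeadingTerm
import Summits.BirchSwinnertonDyer.BirchSwinnertonDyer.Theses.SelmerRank
import Summits.BirchSwinnertonDyer.BirchSwinnertonDyer.Theorems.LeadingTermConsistencyCells
import Summits.BirchSwinnertonDyer.BirchSwinnertonDyer.Theorems.LeadingTermConsistencyStubDeficientTwoLeMatch
import HarnessLib

/-!
# BirchSwinnertonDyer / LeadingTerm — crux `Consistency` (stmt-16217), line `Sketch`:
# the route's conclusion WITHOUT the crux, modulo items (kernel-checked ROUTE NOTE 2)

Line `Sketch` (leads `…-16217-0`, `-c1-0`, `-c2-0`) reduced the crux `Consistency` (#2) to its diagonal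
`r_MW = r_an ≥ 2` (stub S2, conjecture-grade) and closed every DEFICIENT cell `r_MW < r_an` modulo the
items `KatoCorankBound` (#5, stmt-18048) and route SelmerRank's `SelmerRankLB` (stmt-0131),
`SelmerRankSmallImage` (stmt-14418) (`deficient_coeff_eq_zero_of_items`, p133294). The route's certified
deciding theorem `closes (hC : Consistency) (hP : PinchPrime) (hUB : SqueezeUBR2)` CONSUMES `Consistency`
only in deficient cells (on the diagonal there is nothing to prove, in excess cells `SqueezeUBR2` is
violated). This file makes that bookkeeping a theorem:

* `deficientVanishing_of_items` — the three items empty every deficient cell INCLUDING `r_MW = 0`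
  (`r_MW = 0 < r_an`: `L(E,1) = 0`, so the Mazur–Swinnerton-Dyer interpolation — read off the landed
  rank-zero consistency `leadingTerm_consistency_of_rank_zero` — gives `[T⁰]L_p = 0`):
  `r_MW < r_an ⇒ [T^{r_MW}] L_p(f, α_p, T) = 0` at every good ordinary `p ≥ 5`.
* `bsd_of_pinchPrime_of_deficientVanishing` — DEFICIENT VANISHING (spelled out) `→ PinchPrime → SqueezeUBR2 →
  BirchSwinnertonDyer`: at the pinch prime of a global minimal model `ord_T L_p = r_MW`, so
  `[T^{r_MW}]L_p ≠ 0`, so the cell is not deficient; with UB, `r_an = r_MW` (transport of both ranks along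
  the change of variables by the landed (T1)/(T3) lemmas of `LeadingTermLBOfCruxes`).
* `bsd_of_items_without_consistency` — hence
  `PinchPrime → SqueezeUBR2 → KatoCorankBound → SelmerRankLB → SelmerRankSmallImage → BirchSwinnertonDyer`:
  the summit statement from the route's cruxes #3, #4, #5 and the two SelmerRank items, with crux #2
  (and its open stub S2 = the rank-≥2 p-adic Beilinson formula) NOT among the hypotheses.

Nothing is asserted unconditionally about any item; every item enters as an explicit hypothesis. For the
planner (D-0014): modulo items the crux `Consistency` is equivalent to S2 (`consistency_iff_diagonalTwoLe_of_items`,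
p134196) and is dispensable for `closes` (this file); what the route pays for dropping it is exactly
`SelmerRankLB` (open from `r_an = 4`) in place of S2 (open from `r = 2`).
-/

set_option linter.dupNamespace false

namespace Summit.BirchSwinnertonDyer.BirchSwinnertonDyer.Theorems

open scoped MatrixGroups ModularForm
open CongruenceSubgroup Literature.NumberTheory.EllipticCurves
  Literature.NumberTheory.EllipticCurves.ModularForms WeierstrassCurve
open Summit.BirchSwinnertonDyer.BirchSwinnertonDyer.Theses.LeadingTerm (PinchPrime SqueezeUBR2
  KatoCorankBound)
open Summit.BirchSwinnertonDyer.BirchSwinnertonDyer.Theses.SelmerRank (SelmerRankLB SelmerRankSmallImage)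

/-- **Deficient vanishing from the items, all ranks.** From `SelmerRankLB`, `SelmerRankSmallImage` and
`KatoCorankBound`: for every elliptic `E/ℚ` (globally minimal `W`), every good ordinary `p ≥ 5` and the
newform `f` of `E`, if `r_MW < r_an` then `[T^{r_MW}] L_p(f, α_p, T) = 0`. For `r_MW ≥ 1` this is the landed
`deficient_coeff_eq_zero_of_items` (`r_MW < r_an ≤ corank Sel_{p^∞} ≤ ord_T L_p`); for `r_MW = 0` it is the
interpolation `L_p(f, α_p, 0) = (1 − α_p⁻¹)² L(E,1)/Ω⁺_f` with `L(E,1) = 0`, read off the rank-zero leading-term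
consistency (`leadingTerm_consistency_of_rank_zero`, any height datum — here the zero datum).
[cite: Kato2004Asterisque, Thm 18.4; MazurTateTeitelbaum1986Invent, §I.14] -/
theorem deficientVanishing_of_items (hLB : SelmerRankLB) (hSI : SelmerRankSmallImage)
    (hKC : KatoCorankBound) :
    ∀ (W : WeierstrassCurve ℚ) [W.IsElliptic] [W.IsGloballyMinimal] (p : ℕ) [Fact p.Prime],
      5 ≤ p → IsOrdinaryAt W p → ∀ ⦃N : ℕ⦄ [NeZero N] (f : CuspForm (Gamma0 N) 2), IsNewformOf W f →
        W.mordellWeilRank < W.analyticRank →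
          PowerSeries.coeff W.mordellWeilRank (padicLFunction f (unitRoot W p : ℚ_[p])) = 0 := by
  intro W _ _ p _ h5 hord N _ f hf hlt
  rcases Nat.eq_zero_or_pos W.mordellWeilRank with h0 | hpos
  · -- rank 0: interpolation with `L(E,1) = 0`, via the rank-zero consistency at the zero datum
    obtain ⟨hreg, hΩ, q, hA, hP⟩ := leadingTerm_consistency_of_rank_zero W p hord h0
      ⟨0, fun _ _ => rfl, fun _ _ _ => rfl⟩ f hf
    have hL : iteratedDeriv W.mordellWeilRank W.entireLFunction 1 = 0 :=
      iteratedDeriv_entireLFunction_eq_zero_of_lt_analyticRank W hlt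
    have hq : q = 0 := by
      rw [hL] at hA
      have hfac : (0 : ℝ) < W.mordellWeilRank.factorial := by exact_mod_cast Nat.factorial_pos _
      have h : ((W.mordellWeilRank.factorial : ℝ) * (q : ℝ) * plusPeriod f * W.regulator : ℝ) = 0 := by
        exact_mod_cast hA.symm
      have hne : (W.mordellWeilRank.factorial : ℝ) * plusPeriod f * W.regulator ≠ 0 :=
        mul_ne_zero (mul_ne_zero hfac.ne' hΩ.ne') hreg.ne'
      have : (q : ℝ) * ((W.mordellWeilRank.factorial : ℝ) * plusPeriod f * W.regulator) = 0 := by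
        linear_combination h
      exact_mod_cast (mul_eq_zero.mp this).resolve_right hne
    subst hq
    have h := hP
    rw [h0, pow_zero, mul_one] at h
    rw [h0, h]
    push_cast
    ring
  · exact deficient_coeff_eq_zero_of_items hLB hSI hKC W p h5 hord f hf hpos hlt

/-- **The deciding theorem with DEFICIENT VANISHING in place of the crux.** If in every deficient cell
`r_MW < r_an` the `r_MW`-th coefficient of `L_p` vanishes (at every good ordinary `p ≥ 5`, for the newform of
the curve), then `PinchPrime` and `SqueezeUBR2` give BSD-rank: pass to a global minimal model (ranks are
invariant: `leadingTerm_mordellWeilRank_smul`, `leadingTerm_entireLFunction_smul`), take its pinch prime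
(`ord_{T=0} L_p = r_MW`, so `[T^{r_MW}]L_p ≠ 0` by `PowerSeries.order_eq_nat`); the cell is therefore not
deficient, `r_an ≤ r_MW`, and `SqueezeUBR2` is the other inequality. [folklore] -/
theorem bsd_of_pinchPrime_of_deficientVanishing
    (hDV : ∀ (W : WeierstrassCurve ℚ) [W.IsElliptic] [W.IsGloballyMinimal] (p : ℕ) [Fact p.Prime],
      5 ≤ p → IsOrdinaryAt W p → ∀ ⦃N : ℕ⦄ [NeZero N] (f : CuspForm (Gamma0 N) 2), IsNewformOf W f →
        W.mordellWeilRank < W.analyticRank →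
          PowerSeries.coeff W.mordellWeilRank (padicLFunction f (unitRoot W p : ℚ_[p])) = 0)
    (hP : PinchPrime) (hUB : SqueezeUBR2) : _root_.BirchSwinnertonDyer := by
  intro W hW
  haveI : W.IsElliptic := hW
  have hub : W.mordellWeilRank ≤ W.analyticRank := hUB W
  refine le_antisymm ?_ hub
  by_contra hlt
  push Not at hlt
  -- pass to a global minimal model and pinch there
  obtain ⟨C, hCmin⟩ := WeierstrassCurve.hasGlobalMinimalModel_rat_holds W
  haveI : (C • W).IsGloballyMinimal := hCmin
  have hMW : (C • W).mordellWeilRank = W.mordellWeilRank := leadingTerm_mordellWeilRank_smul W C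
  have hAN : (C • W).analyticRank = W.analyticRank := by
    simp only [WeierstrassCurve.analyticRank, leadingTerm_entireLFunction_smul W C]
  have hlt' : (C • W).mordellWeilRank < (C • W).analyticRank := by rw [hMW, hAN]; exact hlt
  obtain ⟨p, hp, h5, hord, -, -, N, hN, f, hf, horder⟩ := hP (C • W)
  haveI : Fact p.Prime := hp
  haveI : NeZero N := hN
  have hcoeff : PowerSeries.coeff (C • W).mordellWeilRank
      (padicLFunction f (unitRoot (C • W) p : ℚ_[p])) ≠ 0 :=
    (PowerSeries.order_eq_nat.mp horder).1
  exact hcoeff (hDV (C • W) p h5 hord f hf hlt')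

/-- **BSD-rank from the route's items WITHOUT the crux `Consistency`.**
`PinchPrime → SqueezeUBR2 → KatoCorankBound → SelmerRankLB → SelmerRankSmallImage → BirchSwinnertonDyer`:
cruxes #3, #4, #5 of route LeadingTerm and the two SelmerRank items already used by line `Sketch` imply the
summit statement; crux #2 (`Consistency`, whose residual stub S2 is the rank-`≥ 2` `p`-adic Beilinson formula)
is not a hypothesis. Kernel-checked form of the lead's ROUTE NOTE 2 (D-0014). [folklore] -/
theorem bsd_of_items_without_consistency :
    Summit.BirchSwinnertonDyer.BirchSwinnertonDyer.Theses.LeadingTerm.PinchPrime →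
    Summit.BirchSwinnertonDyer.BirchSwinnertonDyer.Theses.LeadingTerm.SqueezeUBR2 →
    Summit.BirchSwinnertonDyer.BirchSwinnertonDyer.Theses.LeadingTerm.KatoCorankBound →
    Summit.BirchSwinnertonDyer.BirchSwinnertonDyer.Theses.SelmerRank.SelmerRankLB →
    Summit.BirchSwinnertonDyer.BirchSwinnertonDyer.Theses.SelmerRank.SelmerRankSmallImage →
    BirchSwinnertonDyer :=
  fun hP hUB hKC hLB hSI =>
    bsd_of_pinchPrime_of_deficientVanishing (deficientVanishing_of_items hLB hSI hKC) hP hUB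

end Summit.BirchSwinnertonDyer.BirchSwinnertonDyer.Theorems
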